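import Summits.QuantumFields.YangMills.Theorems.SwapVirialDeficitSectorLaplaceTipDetModRot
import Summits.QuantumFields.YangMills.Theorems.SwapVirialDeficitSectorLaplaceMbDensitySoftCeilHub
import HarnessLib

/-!
# Route `SwapVirialDeficit` (YangMills): T1 AT THE TIP HUB WITH THE FOLLOWER DETERMINANT REFERRED TO THE APEX BASE POINT — hCore brick (C2-match) of w3 g68's memo-hCore §2(iv)
# (cell ym-idea-1, skeleton ➎, `stub_core_tip`, the core `δ_t > δ_b`; free-hands support of ⟨stmt-QuantumFields-24197⟩ `SwapVirialDeficit.SwapGluedStiffness`)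

★★★ `tip_follower_ceiling_mod_rot` — at the tip hub `hubAt δ_t 1` (`δ_t > 0`, angle window `122689728·δ_t⁻¹·L⁴ ≤ μ_F∕(4·3|Fol L|)`), good signs, a T1-admissible leader point `ℓ`
(`ℓ.2.2 = 0`, relations `≤ s_T`, `s_T² ≤ μ_F²∕(304992000000L⁸)`, `F̂(ℓ) ≤ κ_f ≤ κ_T1`) that is a ROTATED NEAR-FLAT point — `‖gnoRot ū ℓ − gnoBase p′‖ ≤ r₁` for a unit `u` and a base
point `p′` with `44712000·L⁴·(r₁ + √(κ_f∕μ_F)) ≤ μ_F∕(2·3|Fol L|)` —, and any apex family `A₀` (hub `1`; symmetric, fibre∕ray∕ambient identities):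
`∃ y⋆, ‖y⋆‖² ≤ F̂(ℓ)∕μ_F ∧ (∀ y, F̂(ℓ + ι y⋆) ≤ F̂(ℓ + ι y)) ∧ ∀ b > 0,
 ∫ e^{−bF̂(ℓ + ι y)}·piWeight(y) dy ≤ e^{−bF̂(ℓ + ι y⋆)}·(e·Gauss_b∕√det A₀(gnoBase p′)) + e^{−b(F̂(ℓ + ι y⋆) + κ_R)}·∫piWeight`
— w2 g60's ✓`follower_laplace_ceiling` (T1) at the hub `hubAt δ_t 1` VERBATIM, its `1∕√det A_F^{δ_t}(η⋆)` replaced by `e∕√D_apex(p′)` through ✓`abs_log_det_tip_mod_rot` (w2 g61: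
angle matching + exact apex isotropy + translation matching; `ζ = gnoRot ū η⋆ = gnoRot ū ℓ + ι(R y⋆)` by ✓`exists_gnoFolRot`, `η⋆ = gnoRot u ζ` by ✓`gnoRot_star_gnoRot`).
With ✓`apexRef_le_mbDensity_hubAt` the right side is shell currency.  Letters-free: g68's `(τ⃗, ρ⃗)` decomposition supplies `u, p′, r₁` (✓`exists_gnoRot_gnoBase_eq_jointTilt`).

HONEST LABEL: composition of landed bricks; the leader Gaussians in g68's letters (F3), the `p`-scaling Fubini (v), the stiff-far∕off-tube tails, the corner of the core and the
assembly of `stub_core_tip`, ⟨24197⟩ ∕ ⟨24194⟩ remain OPEN; own crux ⟨22884⟩ `LargeFieldMassRefinementTail` OPEN (blocked-on ⟨19935⟩); the Yang–Mills mass gap is NOT proved;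
no summit is proved by a line.  THEOREMS ONLY (0 `def`, 0 `sorry`, no instance), standard axioms.  Width seat ym-line-sfw-p2-w2 g61 (cell ym-idea-1, free hands),
`--supports stmt-QuantumFields-24197`.  References: [cite: Luscher1983, §2]; [cite: Breitung1994, Lemma 26]; [folklore].
-/

set_option autoImplicit false
set_option synthInstance.maxSize 1024

noncomputable section

open MeasureTheory Quaternion Set Module
open scoped Quaternion BigOperators ENNReal InnerProductSpace
open Literature.MathematicalPhysics.QuantumLattice
open Literature.MathematicalPhysics.QuantumFieldTheory hiding SU2

namespace Summit.QuantumFields.YangMills.Theorems.SwapVirialDeficit.SectorLaplace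

open Summit.QuantumFields.YangMills.Theorems.FemtoTransferGap
open Summit.QuantumFields.YangMills.Theorems.FemtoTransferGap.TT
open Summit.QuantumFields.YangMills.Theorems.VirialFluxGap.RingDeficit
open Summit.QuantumFields.YangMills.Theorems.SwapVirialDeficit.SwapRing
open Summit.QuantumFields.YangMills.Theorems.SwapVirialDeficit.BlowUpRing
open Summit.QuantumFields.YangMills.Theorems.SwapVirialDeficit.Gnomonic (piWeight)

variable {L : ℕ} [NeZero L]

set_option maxHeartbeats 1600000 in
/-- ★★★ **T1 AT THE TIP HUB, FOLLOWER DETERMINANT REFERRED TO THE APEX BASE POINT MODULO THE ROTATION** (see the file header). [cite: Luscher1983, §2] [cite: Breitung1994, Lemma 26] -/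
theorem tip_follower_ceiling_mod_rot {ε : GnoSign L} (hε : GoodSign ε) {δt : ℝ} (hδt : 0 < δt)
    (hwinδ : 122689728 * δt⁻¹ * (L : ℝ) ^ 4 ≤ (2304 * (L : ℝ) ^ 6 * (Fintype.card (Fol L) : ℝ))⁻¹ / (4 * (3 * (Fintype.card (Fol L) : ℝ))))
    {A0 : GnoCoord L → GnoFol L →ₗ[ℝ] GnoFol L} (hA0s : ∀ η, (A0 η).IsSymmetric)
    (hA0yy : ∀ η (y : GnoFol L), ⟪A0 η y, y⟫_ℝ = iteratedFDeriv ℝ 2 (fun y' : GnoFol L => gnoDeficit z₀ (fun _ => 1) ((1 : ℝ) : ℍ) ε (η + gnoFolEmb y')) 0 (fun _ => y))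
    (hA0ray : ∀ η (y : GnoFol L), ⟪A0 η y, y⟫_ℝ = iteratedDeriv 2 (fun s : ℝ => gnoDeficit (fun _ => false) (fun _ => 1) ((1 : ℝ) : ℍ) ε (η + s • gnoFolEmb y)) 0)
    (hA0amb : ∀ η (y : GnoFol L), ⟪A0 η y, y⟫_ℝ = iteratedFDeriv ℝ 2 (gnoDeficit z₀ (fun _ => 1) ((1 : ℝ) : ℍ) ε) η (fun _ => gnoFolEmb y))
    (ℓ : GnoCoord L) (hℓ : ℓ.2.2 = 0) {sT κf : ℝ} (hsT : 0 ≤ sT)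
    (hCC : ∀ μ ν : Fin 3, frobNorm ((((blowUpPoint 1 (gnomonicPoint (hubAt δt 1) ε ℓ)).1 (Fin.castSucc μ) * (blowUpPoint 1 (gnomonicPoint (hubAt δt 1) ε ℓ)).1 (Fin.castSucc ν) : SU2) :
        Matrix (Fin 2) (Fin 2) ℂ) - (((blowUpPoint 1 (gnomonicPoint (hubAt δt 1) ε ℓ)).1 (Fin.castSucc ν) * (blowUpPoint 1 (gnomonicPoint (hubAt δt 1) ε ℓ)).1 (Fin.castSucc μ) : SU2) :
        Matrix (Fin 2) (Fin 2) ℂ)) ≤ sT)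
    (hσ : ∀ μ : Fin 3, frobNorm ((((blowUpPoint 1 (gnomonicPoint (hubAt δt 1) ε ℓ)).1 (Fin.last 3) *
        (blowUpPoint 1 (gnomonicPoint (hubAt δt 1) ε ℓ)).1 (Fin.castSucc (Equiv.swap (0 : Fin 3) 1 μ)) : SU2) : Matrix (Fin 2) (Fin 2) ℂ) -
        (((blowUpPoint 1 (gnomonicPoint (hubAt δt 1) ε ℓ)).1 (Fin.castSucc μ) * (blowUpPoint 1 (gnomonicPoint (hubAt δt 1) ε ℓ)).1 (Fin.last 3) : SU2) : Matrix (Fin 2) (Fin 2) ℂ)) ≤ sT)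
    (hs2 : sT ^ 2 ≤ ((2304 * (L : ℝ) ^ 6 * (Fintype.card (Fol L) : ℝ))⁻¹) ^ 2 / (304992000000 * (L : ℝ) ^ 8))
    (hκf : κf ≤ (2304 * (L : ℝ) ^ 6 * (Fintype.card (Fol L) : ℝ))⁻¹ * ((2304 * (L : ℝ) ^ 6 * (Fintype.card (Fol L) : ℝ))⁻¹ / (6 * (2484000 * (L : ℝ) ^ 4))) ^ 2 / 4)
    (hflat : gnoDeficit (fun _ => false) (fun _ => 1) (hubAt δt 1) ε ℓ ≤ κf)
    {u : ℍ} (hu : ‖u‖ = 1) (p' : ℝ × ℝ) {r₁ : ℝ} (hrot : ‖gnoRot (star u) ℓ - gnoBase p'.1 p'.2‖ ≤ r₁)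
    (hnear : 44712000 * (L : ℝ) ^ 4 * (r₁ + Real.sqrt (κf / (2304 * (L : ℝ) ^ 6 * (Fintype.card (Fol L) : ℝ))⁻¹)) ≤
      (2304 * (L : ℝ) ^ 6 * (Fintype.card (Fol L) : ℝ))⁻¹ / (2 * (3 * (Fintype.card (Fol L) : ℝ)))) :
    ∃ ys : GnoFol L,
      ‖ys‖ ^ 2 ≤ gnoDeficit (fun _ => false) (fun _ => 1) (hubAt δt 1) ε ℓ / (2304 * (L : ℝ) ^ 6 * (Fintype.card (Fol L) : ℝ))⁻¹ ∧
      (∀ y : GnoFol L, gnoDeficit (fun _ => false) (fun _ => 1) (hubAt δt 1) ε (ℓ + gnoFolEmb ys) ≤ gnoDeficit (fun _ => false) (fun _ => 1) (hubAt δt 1) ε (ℓ + gnoFolEmb y)) ∧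
      ∀ b : ℝ, 0 < b →
        ∫ y : GnoFol L, Real.exp (-(b * gnoDeficit (fun _ => false) (fun _ => 1) (hubAt δt 1) ε (ℓ + gnoFolEmb y))) * piWeight (gnoFolBlocks y) ≤
          Real.exp (-(b * gnoDeficit (fun _ => false) (fun _ => 1) (hubAt δt 1) ε (ℓ + gnoFolEmb ys))) *
              (Real.exp 1 * (2 * Real.pi / ((1 - 1 / (2 * (finrank ℝ (GnoFol L) : ℝ))) * b)) ^ ((finrank ℝ (GnoFol L) : ℝ) / 2) /
                Real.sqrt (LinearMap.det (A0 (gnoBase p'.1 p'.2)))) +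
            Real.exp (-(b * (gnoDeficit (fun _ => false) (fun _ => 1) (hubAt δt 1) ε (ℓ + gnoFolEmb ys) +
                (2304 * (L : ℝ) ^ 6 * (Fintype.card (Fol L) : ℝ))⁻¹ *
                  (3 * ((2304 * (L : ℝ) ^ 6 * (Fintype.card (Fol L) : ℝ))⁻¹ / 2) / (2 * (finrank ℝ (GnoFol L) : ℝ) * (2484000 * (L : ℝ) ^ 4))) ^ 2 / 4))) *
              ∫ y : GnoFol L, piWeight (gnoFolBlocks y) := by
  have hL : (0 : ℝ) < (L : ℝ) := Nat.cast_pos.2 (Nat.pos_of_ne_zero (NeZero.ne L))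
  set μ : ℝ := (2304 * (L : ℝ) ^ 6 * (Fintype.card (Fol L) : ℝ))⁻¹ with hμ
  have hμ0 : 0 < μ := (folMu_pos_le (L := L)).1
  have ha : hubAt δt 1 ≠ 0 := hubAt_one_ne_zero δt
  -- the tip family and T1 at the tip hub
  obtain ⟨At, hAts, -, hAtyy, hAtray, hAtamb, -, -⟩ := exists_gnoFolHessian (fun _ => false) (fun _ => (1 : SU2)) ha ε
  have hflat' : gnoDeficit (fun _ => false) (fun _ => 1) (hubAt δt 1) ε ℓ ≤ μ * (μ / (6 * (2484000 * (L : ℝ) ^ 4))) ^ 2 / 4 := hflat.trans hκf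
  obtain ⟨ys, hys, hglob, hcoer, hT1⟩ := follower_laplace_ceiling ha ε hε.2 ℓ hℓ hAts hAtyy hAtray hsT hCC hσ hs2 hflat'
  refine ⟨ys, hys, hglob, fun b hb => ?_⟩
  -- the rotated near-flat point
  have hu' : ‖star u‖ = 1 := by rw [norm_star]; exact hu
  obtain ⟨R, -, hRη⟩ := exists_gnoFolRot (L := L) hu'
  set ζ : GnoCoord L := gnoRot (star u) (ℓ + gnoFolEmb ys) with hζ
  have hζeq : ζ = gnoRot (star u) ℓ + gnoFolEmb (R ys) := by rw [hζ, hRη]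
  have hηζ : gnoRot u ζ = ℓ + gnoFolEmb ys := by
    rw [hζ]
    have h := gnoRot_star_gnoRot (L := L) hu' (ℓ + gnoFolEmb ys)
    rw [star_star] at h
    exact h
  have hys_norm : ‖ys‖ ≤ Real.sqrt (κf / μ) := by
    rw [← Real.sqrt_sq (norm_nonneg ys)]
    exact Real.sqrt_le_sqrt (hys.trans (div_le_div_of_nonneg_right hflat hμ0.le))
  have hflatζ : 44712000 * (L : ℝ) ^ 4 * ‖ζ - gnoBase p'.1 p'.2‖ ≤ μ / (2 * (3 * (Fintype.card (Fol L) : ℝ))) := by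
    refine le_trans ?_ hnear
    have h1 : ‖ζ - gnoBase p'.1 p'.2‖ ≤ r₁ + Real.sqrt (κf / μ) := by
      rw [hζeq, show gnoRot (star u) ℓ + gnoFolEmb (R ys) - gnoBase p'.1 p'.2 = (gnoRot (star u) ℓ - gnoBase p'.1 p'.2) + gnoFolEmb (R ys) by abel]
      refine (norm_add_le _ _).trans (add_le_add hrot ?_)
      exact (norm_gnoFolEmb_le _).trans (by rw [LinearIsometryEquiv.norm_map]; exact hys_norm)
    exact mul_le_mul_of_nonneg_left h1 (by positivity)
  -- the angle window of the tip hub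
  have eθt : gnoDeficit (fun _ => false) (fun _ => (1 : SU2)) (hubAt δt 1) ε =
      gnoDeficit (fun _ => false) (fun _ => 1) (angUnit (Real.pi / 2 - Real.arctan δt)) ε :=
    funext fun η => gnoDeficit_hubAt_eq_angUnit _ _ δt ε η
  have hAtamb' : ∀ η (y : GnoFol L), ⟪At η y, y⟫_ℝ =
      iteratedFDeriv ℝ 2 (gnoDeficit z₀ (fun _ => 1) (angUnit (Real.pi / 2 - Real.arctan δt)) ε) η (fun _ => gnoFolEmb y) :=
    fun η y => by rw [← eθt]; exact hAtamb η y
  have hθt0 : 0 < Real.pi / 2 - Real.arctan δt := (hubAngle_mem δt).1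
  have hwinθ : 122689728 * |Real.pi / 2 - Real.arctan δt| * (L : ℝ) ^ 4 ≤ μ / (4 * (3 * (Fintype.card (Fol L) : ℝ))) := by
    rw [abs_of_pos hθt0]
    exact le_trans (by gcongr; exact hubAngle_le_inv hδt) hwinδ
  have hlog := abs_log_det_tip_mod_rot hε (sin_hubAngle_pos δt).le hAts hAtamb' hA0s hA0yy hA0ray hA0amb hwinθ hu ζ p' hflatζ
  rw [hηζ] at hlog
  -- determinants: `1/√det A_t(η⋆) ≤ e/√det A₀(gnoBase p′)`
  have h1ne : ((1 : ℝ) : ℍ) ≠ 0 := by exact_mod_cast one_ne_zero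
  have hdet0 : μ ^ finrank ℝ (GnoFol L) ≤ LinearMap.det (A0 (gnoBase p'.1 p'.2)) := det_gnoFolHessian_base_ge h1ne ε hε.1 hε.2 p'.1 p'.2 hA0s hA0ray
  have hdet0' : 0 < LinearMap.det (A0 (gnoBase p'.1 p'.2)) := lt_of_lt_of_le (by positivity) hdet0
  have hdett : (μ / 2) ^ finrank ℝ (GnoFol L) ≤ LinearMap.det (At (ℓ + gnoFolEmb ys)) := det_ge_pow_of_coercive (hAts _) (by positivity) hcoer
  have hdett' : 0 < LinearMap.det (At (ℓ + gnoFolEmb ys)) := lt_of_lt_of_le (by positivity) hdett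
  have hsqrt : (Real.sqrt (LinearMap.det (At (ℓ + gnoFolEmb ys))))⁻¹ ≤ Real.exp 1 * (Real.sqrt (LinearMap.det (A0 (gnoBase p'.1 p'.2))))⁻¹ := by
    have hlog1 : Real.log (LinearMap.det (A0 (gnoBase p'.1 p'.2))) ≤ Real.log (LinearMap.det (At (ℓ + gnoFolEmb ys))) + 2 := by
      have h2 := (abs_sub_le_iff.1 hlog).2
      linarith
    have h1 : LinearMap.det (A0 (gnoBase p'.1 p'.2)) ≤ Real.exp 2 * LinearMap.det (At (ℓ + gnoFolEmb ys)) := by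
      rw [← Real.exp_log hdet0', ← Real.exp_log hdett', ← Real.exp_add, add_comm]
      exact Real.exp_le_exp.2 hlog1
    have h2 : Real.exp 2 = Real.exp 1 ^ 2 := by rw [← Real.exp_nat_mul]; norm_num
    have h3 : Real.sqrt (LinearMap.det (A0 (gnoBase p'.1 p'.2))) ≤ Real.exp 1 * Real.sqrt (LinearMap.det (At (ℓ + gnoFolEmb ys))) := by
      calc Real.sqrt (LinearMap.det (A0 (gnoBase p'.1 p'.2))) ≤ Real.sqrt (Real.exp 2 * LinearMap.det (At (ℓ + gnoFolEmb ys))) := Real.sqrt_le_sqrt h1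
        _ = Real.exp 1 * Real.sqrt (LinearMap.det (At (ℓ + gnoFolEmb ys))) := by
            rw [Real.sqrt_mul (Real.exp_pos _).le, h2, Real.sqrt_sq (Real.exp_pos _).le]
    have hD0 : 0 < Real.sqrt (LinearMap.det (A0 (gnoBase p'.1 p'.2))) := Real.sqrt_pos.2 hdet0'
    have hDt : 0 < Real.sqrt (LinearMap.det (At (ℓ + gnoFolEmb ys))) := Real.sqrt_pos.2 hdett'
    rw [← one_div, ← one_div, ← div_eq_mul_one_div, div_le_div_iff₀ hDt hD0]
    linarith
  -- assemble
  refine (hT1 b hb).trans ?_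
  have hd9 := nine_le_finrank_gnoFol (L := L)
  have hd1 : 0 < 1 - 1 / (2 * (finrank ℝ (GnoFol L) : ℝ)) := by
    rw [sub_pos, div_lt_one (by positivity)]; linarith
  have hGb : 0 ≤ (2 * Real.pi / ((1 - 1 / (2 * (finrank ℝ (GnoFol L) : ℝ))) * b)) ^ ((finrank ℝ (GnoFol L) : ℝ) / 2) :=
    Real.rpow_nonneg (div_nonneg (by positivity) (mul_nonneg hd1.le hb.le)) _
  refine add_le_add (mul_le_mul_of_nonneg_left ?_ (Real.exp_pos _).le) le_rfl
  calc (2 * Real.pi / ((1 - 1 / (2 * (finrank ℝ (GnoFol L) : ℝ))) * b)) ^ ((finrank ℝ (GnoFol L) : ℝ) / 2) / Real.sqrt (LinearMap.det (At (ℓ + gnoFolEmb ys)))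
      = (2 * Real.pi / ((1 - 1 / (2 * (finrank ℝ (GnoFol L) : ℝ))) * b)) ^ ((finrank ℝ (GnoFol L) : ℝ) / 2) * (Real.sqrt (LinearMap.det (At (ℓ + gnoFolEmb ys))))⁻¹ :=
          div_eq_mul_inv _ _
    _ ≤ (2 * Real.pi / ((1 - 1 / (2 * (finrank ℝ (GnoFol L) : ℝ))) * b)) ^ ((finrank ℝ (GnoFol L) : ℝ) / 2) *
          (Real.exp 1 * (Real.sqrt (LinearMap.det (A0 (gnoBase p'.1 p'.2))))⁻¹) := mul_le_mul_of_nonneg_left hsqrt hGb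
    _ = Real.exp 1 * (2 * Real.pi / ((1 - 1 / (2 * (finrank ℝ (GnoFol L) : ℝ))) * b)) ^ ((finrank ℝ (GnoFol L) : ℝ) / 2) /
          Real.sqrt (LinearMap.det (A0 (gnoBase p'.1 p'.2))) := by rw [div_eq_mul_inv]; ring

end Summit.QuantumFields.YangMills.Theorems.SwapVirialDeficit.SectorLaplace

end
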